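import Summits.CriticalPhenomena.CardyFormulaZ2.Theorems.CardyIKTransportIKMixedBoxCrossingTransportStubLinkTraceIneqAux

/-!
# Stub `stub_linkTraceIneq` (H4), auxiliary file 2/2: the CONE of the 1D link inequality
# (line `defect-closure-exploration`, reshape v5b, crux `IKMixedBoxCrossing`, stmt-CriticalPhenomena-5911)

Support file (`--supports stmt-CriticalPhenomena-5911`), memo c5 §9.3: the cone `InC` of entrywise nonnegative `2 × 2` matrices
whose two rows and two columns have first/second entry ratio in `[r_*, √3]`, `r_* = 7√3/15`; it is closed under multiplication
(`inC_mul_closed`, registered helper), contains `Smat`, `M1`, `Fmat g - M1` (`g ≥ 2`) and `(Fmat 1 - M1)^2`, and absorbs the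
exceptional generator `Fmat 1 - M1` on both sides (the sharp EXIT LEMMA `exit_M0one`: `p₀ ≤ √3 p₁ ⇒ ratio(p·M0₁) ≥ 7√3/15`).
-/

noncomputable section

namespace Summit.CriticalPhenomena.CardyFormulaZ2.Cruxes.IKMixedBoxCrossing.DefectClosureExploration

open scoped BigOperators Classical
open Finset Matrix

namespace LinkTraceIneqAux

/-! ## §3 The cone and the admissible set -/

/-- THE CONE: entrywise nonnegative `2 × 2` matrices whose columns (`ν 0 e` vs `ν 1 e`) and rows (`ν e 0` vs `ν e 1`) have
ratio first/second entry between `r_*` and `√3`. -/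
def InC (ν : Matrix (Fin 2) (Fin 2) ℝ) : Prop :=
  (∀ i j, 0 ≤ ν i j) ∧ (∀ e, rS * ν 1 e ≤ ν 0 e ∧ ν 0 e ≤ s3 * ν 1 e) ∧ (∀ e, rS * ν e 1 ≤ ν e 0 ∧ ν e 0 ≤ s3 * ν e 1)

/-- Cone membership from the four entries. -/
theorem InC.of_entries {ν : Matrix (Fin 2) (Fin 2) ℝ} {x y z w : ℝ} (hx : ν 0 0 = x) (hz : ν 0 1 = z) (hy : ν 1 0 = y)
    (hw : ν 1 1 = w) (h0 : 0 ≤ x ∧ 0 ≤ y ∧ 0 ≤ z ∧ 0 ≤ w)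
    (hc : rS * y ≤ x ∧ x ≤ s3 * y ∧ rS * w ≤ z ∧ z ≤ s3 * w)
    (hr : rS * z ≤ x ∧ x ≤ s3 * z ∧ rS * w ≤ y ∧ y ≤ s3 * w) : InC ν := by
  refine ⟨?_, ?_, ?_⟩
  · rw [Fin.forall_fin_two, Fin.forall_fin_two, Fin.forall_fin_two, hx, hz, hy, hw]
    exact ⟨⟨h0.1, h0.2.2.1⟩, h0.2.1, h0.2.2.2⟩
  · rw [Fin.forall_fin_two, hx, hz, hy, hw]
    exact ⟨⟨hc.1, hc.2.1⟩, hc.2.2.1, hc.2.2.2⟩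
  · rw [Fin.forall_fin_two, hx, hz, hy, hw]
    exact ⟨⟨hr.1, hr.2.1⟩, hr.2.2.1, hr.2.2.2⟩

/-- The cone is closed under multiplication (mediant inequality; registered helper). -/
theorem inC_mul_closed : ∀ {ν μ : Matrix (Fin 2) (Fin 2) ℝ}, InC ν → InC μ → InC (ν * μ) := by
  intro ν μ hν hμ
  obtain ⟨hν0, hνc, hνr⟩ := hν
  obtain ⟨hμ0, hμc, hμr⟩ := hμ
  refine ⟨fun i j => ?_, fun e => ⟨?_, ?_⟩, fun e => ⟨?_, ?_⟩⟩ <;>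
    simp only [Matrix.mul_apply, Fin.sum_univ_two]
  · exact add_nonneg (mul_nonneg (hν0 i 0) (hμ0 0 j)) (mul_nonneg (hν0 i 1) (hμ0 1 j))
  · nlinarith [(hνc 0).1, (hνc 1).1, hμ0 0 e, hμ0 1 e]
  · nlinarith [(hνc 0).2, (hνc 1).2, hμ0 0 e, hμ0 1 e]
  · nlinarith [(hμr 0).1, (hμr 1).1, hν0 e 0, hν0 e 1]
  · nlinarith [(hμr 0).2, (hμr 1).2, hν0 e 0, hν0 e 1]

/-- `Smat` lies in the cone. -/
theorem InC.smat : InC Smat := by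
  obtain ⟨s00, s01, s10, s11⟩ := Smat_apply
  have hs := s3_gt
  have hs' := s3_lt
  refine InC.of_entries s00 s01 s10 s11 ⟨by norm_num, by linarith, by linarith, by norm_num⟩ ?_ ?_ <;>
    rw [rS_eq] <;> refine ⟨?_, ?_, ?_, ?_⟩ <;> nlinarith [s3_facts.1]

/-- `M1` lies in the cone (all ratios equal `√3`). -/
theorem InC.m1 : InC M1 := by
  obtain ⟨m00, m01, m10, m11⟩ := M1_apply
  have hs := s3_gt
  have hs' := s3_lt
  refine InC.of_entries m00 m01 m10 m11 ⟨by norm_num, by linarith, by linarith, by norm_num⟩ ?_ ?_ <;>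
    rw [rS_eq] <;> refine ⟨?_, ?_, ?_, ?_⟩ <;> nlinarith [s3_facts.1]

/-- For `n ≥ 3`: `A_n - r_* B_n ≥ 3/4 - r_* √3/4` and `B_n - r_* A_n ≥ √3/4 - r_*/4` (lower cone bounds of `Fmat (n-1) - M1`),
by induction from the exact values at `n = 3`. -/
theorem M0_lower (n : ℕ) (hn : 3 ≤ n) :
    3 / 4 - rS * (s3 / 4) ≤ A n - rS * B n ∧ s3 / 4 - rS * (1 / 4) ≤ B n - rS * A n := by
  induction n with
  | zero => omega
  | succ n ih =>
    rcases Nat.lt_or_ge n 3 with hlt | hge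
    · have : n = 2 := by omega
      subst this
      rw [A_three, B_three, rS_eq]
      constructor <;> nlinarith [s3_facts.1, s3_gt, s3_lt]
    · obtain ⟨ih1, ih2⟩ := ih hge
      have hBA := (AB_bounds n).2
      have htB := tA_le_B n (by omega)
      rw [A_succ, B_succ]
      have hr0 : 0 < rS := by rw [rS_eq]; linarith [s3_gt]
      have hr1 : rS ≤ s3 / 2 := by rw [rS_eq]; linarith [s3_gt]
      constructor <;> nlinarith [s3_facts.1, s3_lt]

/-- `13/4 ≤ A_n` for `n ≥ 3`. -/
theorem A_ge_three (n : ℕ) (hn : 3 ≤ n) : 13 / 4 ≤ A n := by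
  induction n with
  | zero => omega
  | succ n ih =>
    rcases Nat.lt_or_ge n 3 with hlt | hge
    · have : n = 2 := by omega
      subst this
      rw [A_three]
    · rw [A_succ]; nlinarith [ih hge, (AB_bounds n).2.1, (lt_trans (by norm_num) s3_gt : (0:ℝ) < s3)]

/-- `Fmat g - M1` lies in the cone for `g ≥ 2`. -/
theorem InC.m0 (g : ℕ) (hg : 2 ≤ g) : InC (Fmat g - M1) := by
  obtain ⟨e00, e01, e10, e11⟩ := M0_apply g
  obtain ⟨l1, l2⟩ := M0_lower (g + 1) (by omega)
  have hBA := (AB_bounds (g + 1)).2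
  have htB := tA_le_B (g + 1) (by omega)
  have hA3 := A_ge_three (g + 1) (by omega)
  have hs := s3_gt
  have hs' := s3_lt
  have hr0 : 0 < rS := by rw [rS_eq]; linarith [s3_gt]
  refine InC.of_entries e00 e01 e10 e11 ⟨?_, ?_, ?_, ?_⟩ ⟨?_, ?_, ?_, ?_⟩ ⟨?_, ?_, ?_, ?_⟩ <;>
    nlinarith [s3_facts.1]

/-- EXIT LEMMA (the sharp step, `r_* = 7√3/15`): a nonnegative vector `(p₀, p₁)` with `p₀ ≤ √3 p₁`, multiplied on the right
by `Fmat 1 - M1 = [[1, 3√3/4],[3√3/4, 3/2]]`, has ratio in `[r_*, √3]`. -/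
theorem exit_M0one {p0 p1 : ℝ} (h0 : 0 ≤ p0) (_h1 : 0 ≤ p1) (hle : p0 ≤ s3 * p1) :
    rS * (p0 * (3 * s3 / 4) + p1 * (3 / 2)) ≤ p0 * 1 + p1 * (3 * s3 / 4) ∧
      p0 * 1 + p1 * (3 * s3 / 4) ≤ s3 * (p0 * (3 * s3 / 4) + p1 * (3 / 2)) := by
  rw [rS_eq]
  constructor <;> nlinarith [s3_facts.1, s3_gt]

/-- The cone absorbs `Fmat 1 - M1` on the right. -/
theorem InC.mul_M0one {ν : Matrix (Fin 2) (Fin 2) ℝ} (hν : InC ν) : InC (ν * (Fmat 1 - M1)) := by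
  obtain ⟨hν0, hνc, hνr⟩ := hν
  obtain ⟨e00, e01, e10, e11⟩ := M0one_apply
  have hs := s3_gt
  have hr0 : 0 < rS := by rw [rS_eq]; linarith [s3_gt]
  have hx : (ν * (Fmat 1 - M1)) 0 0 = ν 0 0 * 1 + ν 0 1 * (3 * s3 / 4) := by
    simp only [Matrix.mul_apply, Fin.sum_univ_two, e00, e10]
  have hz : (ν * (Fmat 1 - M1)) 0 1 = ν 0 0 * (3 * s3 / 4) + ν 0 1 * (3 / 2) := by
    simp only [Matrix.mul_apply, Fin.sum_univ_two, e01, e11]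
  have hy : (ν * (Fmat 1 - M1)) 1 0 = ν 1 0 * 1 + ν 1 1 * (3 * s3 / 4) := by
    simp only [Matrix.mul_apply, Fin.sum_univ_two, e00, e10]
  have hw : (ν * (Fmat 1 - M1)) 1 1 = ν 1 0 * (3 * s3 / 4) + ν 1 1 * (3 / 2) := by
    simp only [Matrix.mul_apply, Fin.sum_univ_two, e01, e11]
  have k0 := exit_M0one (hν0 0 0) (hν0 0 1) (hνr 0).2
  have k1 := exit_M0one (hν0 1 0) (hν0 1 1) (hνr 1).2
  have n00 := hν0 0 0
  have n01 := hν0 0 1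
  have n10 := hν0 1 0
  have n11 := hν0 1 1
  refine InC.of_entries hx hz hy hw ⟨?_, ?_, ?_, ?_⟩ ⟨?_, ?_, ?_, ?_⟩ ⟨k0.1, k0.2, k1.1, k1.2⟩
  · positivity
  · positivity
  · positivity
  · positivity
  · nlinarith [(hνc 0).1, (hνc 1).1]
  · nlinarith [(hνc 0).2, (hνc 1).2]
  · nlinarith [(hνc 0).1, (hνc 1).1]
  · nlinarith [(hνc 0).2, (hνc 1).2]

/-- The cone absorbs `Fmat 1 - M1` on the left. -/
theorem InC.M0one_mul {ν : Matrix (Fin 2) (Fin 2) ℝ} (hν : InC ν) : InC ((Fmat 1 - M1) * ν) := by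
  obtain ⟨hν0, hνc, hνr⟩ := hν
  obtain ⟨e00, e01, e10, e11⟩ := M0one_apply
  have hs := s3_gt
  have hr0 : 0 < rS := by rw [rS_eq]; linarith [s3_gt]
  have hx : ((Fmat 1 - M1) * ν) 0 0 = 1 * ν 0 0 + (3 * s3 / 4) * ν 1 0 := by
    simp only [Matrix.mul_apply, Fin.sum_univ_two, e00, e01]
  have hz : ((Fmat 1 - M1) * ν) 0 1 = 1 * ν 0 1 + (3 * s3 / 4) * ν 1 1 := by
    simp only [Matrix.mul_apply, Fin.sum_univ_two, e00, e01]
  have hy : ((Fmat 1 - M1) * ν) 1 0 = (3 * s3 / 4) * ν 0 0 + (3 / 2) * ν 1 0 := by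
    simp only [Matrix.mul_apply, Fin.sum_univ_two, e10, e11]
  have hw : ((Fmat 1 - M1) * ν) 1 1 = (3 * s3 / 4) * ν 0 1 + (3 / 2) * ν 1 1 := by
    simp only [Matrix.mul_apply, Fin.sum_univ_two, e10, e11]
  have k0 := exit_M0one (hν0 0 0) (hν0 1 0) (hνc 0).2
  have k1 := exit_M0one (hν0 0 1) (hν0 1 1) (hνc 1).2
  have n00 := hν0 0 0
  have n01 := hν0 0 1
  have n10 := hν0 1 0
  have n11 := hν0 1 1
  refine InC.of_entries hx hz hy hw ⟨?_, ?_, ?_, ?_⟩ ⟨?_, ?_, ?_, ?_⟩ ⟨?_, ?_, ?_, ?_⟩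
  · positivity
  · positivity
  · positivity
  · positivity
  · nlinarith [k0.1]
  · nlinarith [k0.2]
  · nlinarith [k1.1]
  · nlinarith [k1.2]
  · nlinarith [(hνr 0).1, (hνr 1).1]
  · nlinarith [(hνr 0).2, (hνr 1).2]
  · nlinarith [(hνr 0).1, (hνr 1).1]
  · nlinarith [(hνr 0).2, (hνr 1).2]

/-- `(Fmat 1 - M1)^2 = [[43/16, 15√3/8], [15√3/8, 63/16]]` lies in the cone. -/
theorem InC.M0one_sq : InC ((Fmat 1 - M1) * (Fmat 1 - M1)) := by
  obtain ⟨e00, e01, e10, e11⟩ := M0one_apply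
  have hx : ((Fmat 1 - M1) * (Fmat 1 - M1)) 0 0 = 43 / 16 := by
    simp only [Matrix.mul_apply, Fin.sum_univ_two, e00, e01, e10]; nlinarith [s3_facts.1]
  have hz : ((Fmat 1 - M1) * (Fmat 1 - M1)) 0 1 = 15 * s3 / 8 := by
    simp only [Matrix.mul_apply, Fin.sum_univ_two, e00, e01, e11]; ring
  have hy : ((Fmat 1 - M1) * (Fmat 1 - M1)) 1 0 = 15 * s3 / 8 := by
    simp only [Matrix.mul_apply, Fin.sum_univ_two, e00, e10, e11]; ring
  have hw : ((Fmat 1 - M1) * (Fmat 1 - M1)) 1 1 = 63 / 16 := by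
    simp only [Matrix.mul_apply, Fin.sum_univ_two, e01, e10, e11]; nlinarith [s3_facts.1]
  have hs := s3_gt
  have hs' := s3_lt
  refine InC.of_entries hx hz hy hw ⟨by norm_num, by positivity, by positivity, by norm_num⟩ ?_ ?_ <;>
    rw [rS_eq] <;> refine ⟨?_, ?_, ?_, ?_⟩ <;> nlinarith [s3_facts.1]

/-- The cone is closed under multiplication (dot-notation alias). -/
theorem InC.mul {ν μ : Matrix (Fin 2) (Fin 2) ℝ} (hν : InC ν) (hμ : InC μ) : InC (ν * μ) := inC_mul_closed hν hμ

end LinkTraceIneqAux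

end Summit.CriticalPhenomena.CardyFormulaZ2.Cruxes.IKMixedBoxCrossing.DefectClosureExploration

end
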